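import Summits.Ventures.PercRepro.SevenThreeBookkeeping
import Summits.Ventures.PercRepro.SevenThreeLineTable

/-!
# PercRepro — the `(7,3)` cell: the bracket of a nullity-one witness is the line table's term (p3, gen 15)

In the reduced world (`SevenThreeBookkeeping.lean`), a witness `S = T ∪ X` of nullity one contains a circuit `C` with
`c = |C| ≥ 3` points (simplicity) and `y = |S| − c = x + 3 − c` coloops (`x = |X|`), and its denominator is Lemma 24.1's
(`SevenThreeNullity.lean`). In the LINE TABLE (`SevenThreeLineTable.lean`) the same denominator is written
`DlineN a x = C(x+3, 3) − C(a, x) + (6 − (3 + x − a))·C(a, x − 1)` with `a = x + 3 − c` — the number of points of the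
witness on the dual line. This file proves the dictionary for the witness range `2 ≤ x ≤ 4`:
`D(S) = DlineN (x + 3 − c) x` (`D_eq_DlineN_of_nullity_one`), hence the bracket of the witness is
`1/DlineN (x + 3 − c) x − [x ≤ 3]/C(x+3, 3)` (`bracket_of_nullity_one`); for `x ≥ 5` the bracket is `0`
(`bracket_of_nullity_one_of_five_le`), and `x ≤ 1` is impossible (`two_le_card_of_nullity_one`: a single point of `W`
would lie in `cl(T)`). These are the per-term identities that the grouping by lines (plan §9 (R3)) sums into `deltaN/Lc`.
-/

namespace PercRepro

namespace SevenThree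

open Finset ThmH SixThree

variable {α : Type*} [DecidableEq α] {M : Matroid α} [M.Finite]

/-- In the reduced world a witness `T ∪ X` of nullity one has `|X| ≥ 2`. -/
theorem two_le_card_of_nullity_one {T W X : Finset α} (h : ReducedWorld M T W) (hX : X ⊆ W) (hne : X ≠ ∅)
    (hnul : M.eRk ((T ∪ X : Finset α) : Set α) + 1 = ((T ∪ X).card : ℕ∞)) : 2 ≤ X.card := by
  by_contra hlt
  have hpos : 1 ≤ X.card := Finset.card_pos.2 (Finset.nonempty_iff_ne_empty.2 hne)
  have h1 : X.card = 1 := by omega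
  obtain ⟨w, rfl⟩ := Finset.card_eq_one.1 h1
  have hw : w ∈ W := hX (Finset.mem_singleton_self _)
  have hwT : w ∉ T := Finset.disjoint_right.1 h.disj hw
  have hcard : (T ∪ {w}).card = 4 := by
    rw [Finset.union_comm, ← Finset.insert_eq, Finset.card_insert_of_notMem hwT, h.T_card]
  have hr : M.eRk ((T ∪ {w} : Finset α) : Set α) = 4 := by
    rw [Finset.union_comm, ← Finset.insert_eq]
    rw [eRk_insert_eq_succ_of_notMem_closure (h.W_sub hw) (h.flat w hw), h.T_rank]
    rfl
  rw [hr, hcard] at hnul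
  norm_num at hnul

/-- The rank of a nullity-one witness: `ρ(T ∪ X) = |X| + 2`. -/
theorem eRk_of_nullity_one {T W X : Finset α} (h : ReducedWorld M T W) (hX : X ⊆ W)
    (hnul : M.eRk ((T ∪ X : Finset α) : Set α) + 1 = ((T ∪ X).card : ℕ∞)) :
    M.eRk ((T ∪ X : Finset α) : Set α) = ((X.card + 2 : ℕ) : ℕ∞) := by
  have hScard : (T ∪ X).card = X.card + 3 := by
    rw [Finset.card_union_of_disjoint (h.disj.mono_right hX), h.T_card]
    ring
  obtain ⟨k, hk, -⟩ := ThmH.eRk_eq_nat M (T ∪ X)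
  rw [hk, hScard] at hnul
  rw [hk]
  have h' : ((k + 1 : ℕ) : ℕ∞) = ((X.card + 3 : ℕ) : ℕ∞) := by rw [Nat.cast_succ]; exact hnul
  have h'' : k + 1 = X.card + 3 := by exact_mod_cast h'
  congr 1
  omega

/-- **Lemma 24.1 as the line table reads it**: for a nullity-one witness `S = T ∪ X` with circuit `C ⊆ S` of `c ≥ 3`
points and `2 ≤ |X| ≤ 4`, `D(S) = DlineN (x + 3 − c) x`. -/
theorem D_eq_DlineN_of_nullity_one {T W X C : Finset α} (h : ReducedWorld M T W) (hX : X ⊆ W)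
    (hCS : C ⊆ T ∪ X) (hC : M.IsCircuit (C : Set α)) (hc3 : 3 ≤ C.card)
    (hcol : ∀ y ∈ T ∪ X, y ∉ C → y ∉ M.closure (((T ∪ X).erase y : Finset α) : Set α))
    (hx2 : 2 ≤ X.card) (hx4 : X.card ≤ 4) :
    D M (T ∪ X) = ((LineTable.DlineN (X.card + 3 - C.card) X.card : ℤ) : ℚ) := by
  have hSg : T ∪ X ⊆ gr M := Finset.union_subset h.T_sub (hX.trans h.W_sub)
  have hScard : (T ∪ X).card = X.card + 3 := by
    rw [Finset.card_union_of_disjoint (h.disj.mono_right hX), h.T_card]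
    ring
  have hy : ((T ∪ X) \ C).card = X.card + 3 - C.card := by
    rw [Finset.card_sdiff_of_subset hCS, hScard]
  have hcle : C.card ≤ X.card + 3 := by
    have := Finset.card_le_card hCS
    omega
  rcases Nat.lt_or_ge C.card 5 with hlt | hge
  · rcases (by omega : C.card = 3 ∨ C.card = 4) with h3 | h4
    · rw [D_of_nullity_one_three hSg hCS hC h3 hcol, hy, h3]
      unfold LineTable.DlineN
      interval_cases X.card <;> norm_num [Nat.choose]
    · rw [D_of_nullity_one_four hSg hCS hC h4 hcol, hy, h4]
      unfold LineTable.DlineN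
      interval_cases X.card <;> norm_num [Nat.choose]
  · rw [D_of_nullity_one_ge_five hSg hCS hC hge hcol, hScard]
    unfold LineTable.DlineN
    have ha : X.card + 3 - C.card + 1 < X.card := by omega
    have h1 : Nat.choose (X.card + 3 - C.card) X.card = 0 := Nat.choose_eq_zero_of_lt (by omega)
    have h2 : Nat.choose (X.card + 3 - C.card) (X.card - 1) = 0 := Nat.choose_eq_zero_of_lt (by omega)
    rw [h1, h2]
    push_cast
    ring_nf

/-- **The bracket of a nullity-one witness** with `2 ≤ |X| ≤ 4` is the line table's term
`1/DlineN (x + 3 − c) x − [x ≤ 3]/C(x+3, 3)`. -/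
theorem bracket_of_nullity_one {T W X C : Finset α} (h : ReducedWorld M T W) (hX : X ⊆ W)
    (hnul : M.eRk ((T ∪ X : Finset α) : Set α) + 1 = ((T ∪ X).card : ℕ∞))
    (hCS : C ⊆ T ∪ X) (hC : M.IsCircuit (C : Set α)) (hc3 : 3 ≤ C.card)
    (hcol : ∀ y ∈ T ∪ X, y ∉ C → y ∉ M.closure (((T ∪ X).erase y : Finset α) : Set α))
    (hx2 : 2 ≤ X.card) (hx4 : X.card ≤ 4) :
    bracket M T X = 1 / ((LineTable.DlineN (X.card + 3 - C.card) X.card : ℤ) : ℚ) -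
      (if X.card ≤ 3 then 1 / (((X.card + 3).choose 3 : ℕ) : ℚ) else 0) := by
  classical
  have hw : IsWitness M T X := by
    unfold IsWitness
    rw [eRk_of_nullity_one h hX hnul]
    constructor
    · exact_mod_cast (by omega : 3 < X.card + 2)
    · exact_mod_cast (by omega : X.card + 2 < 7)
  unfold bracket
  rw [if_pos hw, D_eq_DlineN_of_nullity_one h hX hCS hC hc3 hcol hx2 hx4]

/-- A nullity-one set `T ∪ X` with `|X| ≥ 5` is not a witness and carries no generic term: its bracket is `0`. -/
theorem bracket_of_nullity_one_of_five_le {T W X : Finset α} (h : ReducedWorld M T W) (hX : X ⊆ W)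
    (hnul : M.eRk ((T ∪ X : Finset α) : Set α) + 1 = ((T ∪ X).card : ℕ∞)) (hx5 : 5 ≤ X.card) :
    bracket M T X = 0 := by
  classical
  have hw : ¬ IsWitness M T X := by
    unfold IsWitness
    rw [eRk_of_nullity_one h hX hnul]
    rintro ⟨-, hlt⟩
    have : X.card + 2 < 7 := by exact_mod_cast hlt
    omega
  unfold bracket
  rw [if_neg hw, if_neg (by omega)]
  ring

end SevenThree

end PercRepro
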